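import Summits.QuantumFields.YangMills.Theses.FemtoCutoffLadder
import Summits.QuantumFields.YangMills.Theorems.FemtoCutoffLadderWalledSecondPos
import HarnessLib

/-!
# Route `FemtoCutoffLadder`: the ADDITIVE form of `SmallFieldOctaveStep` (stmt-QuantumFields-25695 = stub A of the crux `OctaveStepDecay` 24153), by name

Seat `leafhand-qf-femtocutoffladder-1` g0 (2026-08-30).  The SF_κ-compressed one-tower octave step compares `s_κ(L,β)^L · t_κ(L',β')^{L'}` with
`e^{a} · s_κ(L',β')^{L'} · t_κ(L,β)^L`, `a = CΛ²/L'^σ + D(1/β' − 1/β)`.  All four factors are positive along the window (`SFCompression.smallFieldTop_pos`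
p607603, `SFCompression.smallFieldSecond_pos` p793746), so the clause is ONE one-sided bound on the compressed femto gap variables
`z_κ(L,β) := L·(log t_κ − log s_κ)`:

* `oneSided_comparison_iff_log` — `s^n t'^m ≤ e^a s'^m t^n ↔ m(log t' − log s') − n(log t − log s) ≤ a` for positive reals;
* ★ `smallFieldOctaveStep_iff_log : SmallFieldOctaveStep ↔ ∃ C σ D κ lam0 L0 … z_κ(L',β') − z_κ(2L',β) ≤ CΛ²/L'^σ + D(1/β' − 1/β)` (prefix and `let`s VERBATIM):
  along one dyadic tower the compressed femto gap does not DROP by more than the summable defect from the coarse to the fine lattice — the stability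
  direction that `OctaveStepDecay` propagates (compare `Trace.towerTraceComparison_iff` for the uncompressed crux).

HONEST FRAMING: a by-name door (bookkeeping with `Real.log`); the bound — two-cutoff convergence with a rate, open behind `UVStabilityNonUniqueness` — is
untouched.  R2b1 is a RECORD rung: not infinite volume, not a mass gap, not Clay; no summit is proved by this file.  No definitions, no `sorry`.
-/

set_option autoImplicit false

noncomputable section

namespace Summit.QuantumFields.YangMills.Theorems.FemtoCutoffLadder

open Literature.MathematicalPhysics.QuantumFieldTheory hiding SU2
open Summit.QuantumFields.YangMills.Theorems.FemtoTransferGap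
open Summit.QuantumFields.YangMills.Theses.FemtoCutoffLadder

/-- **One cross-multiplied comparison ⟺ one one-sided bound on logarithmic gaps**: for positive `s, t, s', t'`,
`s^n · t'^m ≤ e^a · (s'^m · t^n) ↔ m(log t' − log s') − n(log t − log s) ≤ a`. [folklore] -/
theorem oneSided_comparison_iff_log {s t s' t' a : ℝ} (hs : 0 < s) (ht : 0 < t) (hs' : 0 < s') (ht' : 0 < t') (n m : ℕ) :
    s ^ n * t' ^ m ≤ Real.exp a * (s' ^ m * t ^ n) ↔
      (m : ℝ) * (Real.log t' - Real.log s') - (n : ℝ) * (Real.log t - Real.log s) ≤ a := by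
  have h1 : 0 < s ^ n * t' ^ m := mul_pos (pow_pos hs n) (pow_pos ht' m)
  have h2 : 0 < s' ^ m * t ^ n := mul_pos (pow_pos hs' m) (pow_pos ht n)
  rw [← Real.log_le_log_iff h1 (mul_pos (Real.exp_pos a) h2), Real.log_mul (Real.exp_pos a).ne' h2.ne', Real.log_exp,
    Real.log_mul (pow_pos hs n).ne' (pow_pos ht' m).ne', Real.log_mul (pow_pos hs' m).ne' (pow_pos ht n).ne',
    Real.log_pow, Real.log_pow, Real.log_pow, Real.log_pow]
  constructor <;> intro h <;> linarith

/-- ★ **`SmallFieldOctaveStep` ⟺ its additive form**: along one dyadic tower at matched `Λ`, the SF_κ-compressed femto gap variable of the COARSE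
lattice exceeds that of the FINE lattice by at most `CΛ²/L'^σ + D(1/β' − 1/β)` (`oneSided_comparison_iff_log` with `smallFieldTop_pos`,
`smallFieldSecond_pos`; `β, β' ≥ 1` on the windows). [folklore] -/
theorem smallFieldOctaveStep_iff_log :
    SmallFieldOctaveStep ↔
      (∃ (C σ D κ lam0 : ℝ) (L0 : ℕ), 0 < L0 ∧ 0 < σ ∧ 0 < κ ∧ κ < 1 ∧ 0 < lam0 ∧ 0 ≤ C ∧ 0 ≤ D ∧ ∀ lam : ℝ, 0 < lam → lam ≤ lam0 → ∀ (i : ℕ) (L' : ℕ) [NeZero L'] (L : ℕ) [NeZero L], L' = L0 * 2 ^ i → L = 2 * L' → ∀ β β' : ℝ, InFemtoWindow lam β L → InFemtoWindow lam β' L' → luscherLambda β L = luscherLambda β' L' → let P : (Literature.MathematicalPhysics.QuantumFieldTheory.GaugeConfig 3 L SU2 → ℝ) → Prop := fun ψ => ∀ U, (∃ p : Literature.MathematicalPhysics.QuantumFieldTheory.Plaquette 3 L, β ^ (κ - 1) < 2 - (su2Rep (Literature.MathematicalPhysics.QuantumFieldTheory.plaquetteHolonomy U p.1 p.2.1.1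 p.2.1.2)).trace.re) → ψ U = 0; let P' : (Literature.MathematicalPhysics.QuantumFieldTheory.GaugeConfig 3 L' SU2 → ℝ) → Prop := fun ψ => ∀ U, (∃ p : Literature.MathematicalPhysics.QuantumFieldTheory.Plaquette 3 L', β' ^ (κ - 1) < 2 - (su2Rep (Literature.MathematicalPhysics.QuantumFieldTheory.plaquetteHolonomy U p.1 p.2.1.1 p.2.1.2)).trace.re) → ψ U = 0; (L' : ℝ) * (Real.log (sSup (rayleighSet su2Rep L' β' P')) - Real.log (sInf {x : ℝ | ∃ φ : Literature.MathematicalPhysics.QuantumFieldTheory.GaugeConfig 3 L' SU2 → ℝ, IsPhys φ ∧ x = sSup (rayleighSet su2Rep L' β' fun ψ => P' ψ ∧ l2 ψ φ = 0)})) - (L : ℝ) * (Real.log (sSup (rayleighSet su2Rep L β P)) - Real.log (sInf {x : ℝ | ∃ φ : Literature.MathematicalPhysics.QuantumFieldTheory.GaugeConfig 3 L SU2 → ℝ, IsPhys φ ∧ x = sSup (rayleighSet su2Rep L β fun ψ => P ψ ∧ l2 ψ φ = 0)})) ≤ C * luscherLambda β L ^ 2 / (L' : ℝ) ^ σ + D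 * (1 / β' - 1 / β)) := by
  constructor
  · rintro ⟨C, σ, D, κ, lam0, L0, hL0, hσ, hκ, hκ1, hlam0, hC, hD, H⟩
    refine ⟨C, σ, D, κ, lam0, L0, hL0, hσ, hκ, hκ1, hlam0, hC, hD, fun lam hlam hle i L' _ L _ hL' hL β β' hW hW' hΛ => ?_⟩
    have hβ : 0 < β := by linarith [hW.1]
    have hβ' : 0 < β' := by linarith [hW'.1]
    intro P P'
    exact (oneSided_comparison_iff_log (SFCompression.smallFieldSecond_pos L hβ κ) (SFCompression.smallFieldTop_pos L hβ κ)
      (SFCompression.smallFieldSecond_pos L' hβ' κ) (SFCompression.smallFieldTop_pos L' hβ' κ) L L').mp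
      (H lam hlam hle i L' L hL' hL β β' hW hW' hΛ)
  · rintro ⟨C, σ, D, κ, lam0, L0, hL0, hσ, hκ, hκ1, hlam0, hC, hD, H⟩
    refine ⟨C, σ, D, κ, lam0, L0, hL0, hσ, hκ, hκ1, hlam0, hC, hD, fun lam hlam hle i L' _ L _ hL' hL β β' hW hW' hΛ => ?_⟩
    have hβ : 0 < β := by linarith [hW.1]
    have hβ' : 0 < β' := by linarith [hW'.1]
    intro P P'
    exact (oneSided_comparison_iff_log (SFCompression.smallFieldSecond_pos L hβ κ) (SFCompression.smallFieldTop_pos L hβ κ)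
      (SFCompression.smallFieldSecond_pos L' hβ' κ) (SFCompression.smallFieldTop_pos L' hβ' κ) L L').mpr
      (H lam hlam hle i L' L hL' hL β β' hW hW' hΛ)

end Summit.QuantumFields.YangMills.Theorems.FemtoCutoffLadder

end
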